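import Literature.MathematicalPhysics.QuantumFieldTheory.BalabanImbrieJaffe1984to88.BIJ88Eq596Display

/-!
# `BalabanImbrieJaffe1984to88.BIJ88RT552Transl` — T. Bałaban, J. Imbrie, A. Jaffe, *Effective action and cluster properties of the
abelian Higgs model*, Commun. Math. Phys. **114** (1988) 257–315 [BalabanImbrieJaffe1988], Sect. 5.5 *Second Gauge Field Translation*,
(5.5.2) p. 283 [PDF 27] and the sentence after it, p. 284 [PDF 28]: **THE SECOND GAUGE FIELD TRANSLATION AS A CHANGE OF VARIABLES IN THE
DENSITY DISPLAY, AT MEASURE LEVEL** — verbatim: *"So we eliminate most of the linear term by a translation approximately equal to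
Λ₄^{(k)*}L⁻²C^{(k)}H*_k∂*Q^{e*}_{k+1}f. The translation we actually use is localized, and is given by A′ = A^{(k)} − Λ₄^{(k)*}L⁻²C^{(k)}_{loc}H*_{k,loc}∂*Q^{e*}_{k+1}f.
(5.5.2)  Our construction of a C^{(k)}_{loc} satisfying (2.10), (2.11) ensures that δ_{Ax}(A′) = δ_{Ax}(A^{(k)}), δ(QA′) = δ(QA^{(k)})."*
In the variables of line 1 of (5.9.6) (`BIJ88Eq596Display.IsDT`: `u′ = u^{(k)}` the translated unit-lattice gauge field with `u′_b = e^{ie_kA′_b}`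
(p. 280), `v` the block field, `f = (ie_k)⁻¹log v`) the translation is the substitution `u′ = u^{(k)}·s(v)`, `s(v) = exp(−ie_k Λ₄^{(k)*}L⁻²C^{(k)}_{loc}
H*_{k,loc}∂*Q^{e*}_{k+1}f)` a multiplicative shift of the integration variable depending on the FREE components of `v` (those on `Λ₁^{(k)′*}`, where
`f` is read).  PROVED: if `ρ^L_{k+1}` satisfies `IsDT ν terms Λ Q J`, then it satisfies `IsDT ν terms Λ Q J^s` with the SHIFTED INTEGRAND
`J^s_t({u^{(j)}}, u^{(k)}, v, φ, ψ) = J_t({u^{(j)}}, u^{(k)}·s_t(v|_{Λ_t}), v, φ, ψ)`, under the two printed δ-claims as hypotheses, in the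
following honest form (the block average `Q` of record is the NONLINEAR (2.10)–(2.11) with the logarithm in a fixed branch, r18's `qU`; it is
not multiplicative globally, so *"δ(QA′) = δ(QA^{(k)})"* is a statement on the small-field region where the integrand lives):
(A) *"δ_{Ax}(A′) = δ_{Ax}(A^{(k)})"*: the `u`-law `ν` is invariant under `u ↦ u·s_t(w)` for every shift value (for `∫𝒟u δ_{Ax}(u)(·)`: the shift is
trivial on the axial tree bonds, `axialMeasure_map_bondMul` — C^{(k)}_{loc} maps into axial-gauge fields, (2.10) p. 261; for `𝒟u`: always);
(B) *"δ(QA′) = δ(QA^{(k)})"*: there are sets `S_t` of unit-lattice configurations (the small fields of (5.3.1) p. 280, *"u′_b = e^{ie_kA′_b} with |A′_b|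
≦ cp(e_k)"*, enforced by the characteristic functions of Sect. 5.2 inside the integrand) with (B1) `J_t(…, u′, …) ≠ 0 ⇒ u′ ∈ S_t` and (B2) for
`u′ ∈ S_t` the block averages are unchanged by the shift and by its inverse, `Q(u′·s) = Q(u′) = Q(u′·s⁻¹)` ((2.11) `QC^{(k)}_{loc} = 0` p. 261 in the
linear regime — cf. p31's `BIJ88Eq536Linearization`, and p31's `BIJ88Eq552CutoffWitness` for the position of the cut-off `Λ₄^{(k)*}`).  Seat p34
gen 9, file 3 (own lineage = the C1/C2 renormalization-transformation line; the identities (5.5.3)–(5.5.12) computing the new quadratic forms are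
r16's/p31's rows and enter (5.9.6) through `IsDT.congr`).

statement-level skeleton of published theorems with citation tags; proofs where landed; nothing here is a claim about the Yang–Mills mass gap

PDF held: `paper:balaban1988-cmp114-bij-abelian-higgs-effective-action` (journal page = PDF page + 256); pp. 280, 283–284 [PDF 24, 27–28] re-read this
session as images (r16's renders `HOME/lit-balaban-r16/renders/cmp114/original-p024-x2.png`, `…p027…`, `…p028…`).
CITATION HEADER (lean-in-tree rule).  Part of the lit-balaban TYPED SKELETON (HOME `run/shared/lean/pub/lit-balaban/`), PHASE-2 proof seat p34
gen 9 (unit `lit-balaban-p34-g9`; TAKING line HOME/STATUS.md 2026-08-21T21:12:57Z).  Rows served: **`C2.Eq5.5.1-5.5.12`**, member (5.5.2) at measure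
level (owner r16, `HOME/lit-balaban-r16/ROWS-C2-part2.md`; typed decl of record r16's `BIJ88Sect5StatementsPart3.transl552`/`Q_transl552` at field
level), and `C2.Eq5.9.6` (the operation between (5.3.6) and (5.9.6)).

WHAT IS PROVED (theorems, one def with body; 0 `sorry`; no `Prop`-valued fact; standard axioms).
* §1 `bondMul u s` (def: the pointwise product `(u·s)_b = u_b s_b`), its algebra with `surfMul`/`uCut`/`qU`, the measurable equivalence
  `bondMulEquiv s`, **`axialMeasure_map_bondMul`** (`∫𝒟u δ_{Ax}` is invariant under shifts trivial on the tree bonds), `fieldMeasure_map_bondMul`.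
* §2 **`integrand_shift_eq`** — the pointwise heart: under (B1)–(B2), for EVERY configuration, `J_t(u′_Λ(u·σ), v_Λ(u·σ, v′))·g(v_Λ(u·σ, v′)) =
  J_t(u′_Λ(u)·σ, v_Λ(u, v′))·g(v_Λ(u, v′))` (`σ = s_t(v′|_Λ)`): where `Q(u·σ) = Q(u)` the translated variables shift exactly (`uCut_bondMul`); where
  not, BOTH integrand values vanish (each would put a configuration in `S_t` whose shifted block averages differ — (B2) read backwards).
* §3 **`isDT_bondShift`** — (5.5.2) at measure level: `IsDT ν terms Λ qU J ρ̃ → IsDT ν terms Λ qU J^s ρ̃` (for each `v′` the change of variables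
  `u ↦ u·s_t(v′|_Λ)` under `ν`, Mathlib's `MeasurePreserving.integral_comp'` on the measurable equivalence — no integrability needed —, then §2
  pointwise); instances `_axial` (`ν = 𝒟u δ_{Ax}`, shifts trivial on the tree) and `_field` (`ν = 𝒟u`).
NOT DONE HERE (honest scope).  The discharge of (B1)–(B2) for the printed `s` and the printed characteristic functions (the small-field analysis
of p. 280 and (2.10)–(2.11): p31's/r16's rows), the new quadratic forms (5.5.3)–(5.5.12), bounds.  Imports `BIJ88Eq596Display` only.
-/

namespace Literature.MathematicalPhysics.QuantumFieldTheory.BalabanImbrieJaffe1984to88.BIJ88RT552Transl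

open Literature.MathematicalPhysics.QuantumFieldTheory.Balaban1983to89
open BIJ88Sect3Statements (U1 toC toC_mul)
open BIJ88Sect3Rescaling (toC_injective_U1)
open BIJ85Sect1Model (HiggsField)
open BIJ88RenormTransf311 (axialMeasure axialBonds)
open BIJ88InductiveForm41 (Prev prevMeasure)
open BIJ85BlockAveragesTorus (qU surfMul surfFactor measurable_qU map_surfMul_fieldMeasure qU_surfMul)
open BIJ88Eq536Linearization (cutoff)
open BIJ88Eq531TranslLaw (axialMeasure_map_surfMul)
open BIJ88Eq531TranslLawCutoff (cutoff_apply)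
open BIJ88Eq596Display (uCut vCut IsDT uCut_def vCut_apply cutoff_vCut translCut_uCut_qU)
open T4AxialGaugeFixing (fixBonds measurable_fixBonds fixBonds_apply_of_mem fixBonds_apply_of_not_mem)
open scoped BigOperators ENNReal
open _root_.MeasureTheory _root_.MeasureTheory.Measure Complex Function

noncomputable section

variable {P : Params} {k : ℕ}

/-! ## §1 The multiplicative shift of the unit-lattice gauge field and the invariance of the `u`-laws -/

section Shift

/-- **The pointwise product of two unit-lattice gauge field configurations**, `(u·s)_b = u_b s_b` — the multiplicative form `u′ = u^{(k)}·e^{−ie_k(A′−A^{(k)})}`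
of the translation (5.5.2) in the variables `u′_b = e^{ie_kA′_b}` of p. 280. [cite: BalabanImbrieJaffe1988, (5.5.2) p.283] -/
def bondMul (U s : GaugeField P k U1) : GaugeField P k U1 := fun b => U b * s b

/-- kernel: the value of the product. [cite: BalabanImbrieJaffe1988, (5.5.2) p.283] -/
@[simp] theorem bondMul_apply (U s : GaugeField P k U1) (b : PBond P k) : bondMul U s b = U b * s b := rfl

/-- kernel: shifting back, `(u·s)·s⁻¹ = u`. [cite: BalabanImbrieJaffe1988, (5.5.2) p.283] -/
theorem bondMul_bondMul_inv (U s : GaugeField P k U1) : bondMul (bondMul U s) (fun b => (s b)⁻¹) = U := by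
  funext b; simp [bondMul_apply]

/-- kernel: `(u·s⁻¹)·s = u`. [cite: BalabanImbrieJaffe1988, (5.5.2) p.283] -/
theorem bondMul_inv_bondMul (U s : GaugeField P k U1) : bondMul (bondMul U fun b => (s b)⁻¹) s = U := by
  funext b; simp [bondMul_apply]

/-- kernel: `U(1)` is commutative (read in `ℂ`). [folklore] -/
private theorem mul_comm_U1 (a b : U1) : a * b = b * a :=
  toC_injective_U1 (by rw [toC_mul, toC_mul, mul_comm])

/-- kernel: the shift commutes with the substitutions `u ↦ u·Q^{s*}w` of (5.3.1) (both are pointwise multiplications in the abelian `U(1)`).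
[cite: BalabanImbrieJaffe1988, (5.5.2) p.283] -/
theorem surfMul_bondMul (U s : GaugeField P k U1) (w : GaugeField P (k+1) U1) : surfMul (bondMul U s) w = bondMul (surfMul U w) s := by
  funext b
  simp only [surfMul, bondMul_apply]
  rw [mul_assoc, mul_assoc, mul_comm_U1 (s b)]

/-- kernel: **where the block averages are unchanged by the shift, the translated variable shifts exactly**: `Q(u·σ) = Q(u) ⇒ (u·σ)′_Λ = u′_Λ·σ`.
[cite: BalabanImbrieJaffe1988, (5.5.2) p.283] -/
theorem uCut_bondMul {Λ : Finset (PBond P (k+1))} {U σ : GaugeField P k U1} (h : qU (bondMul U σ) = qU U) :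
    uCut qU Λ (bondMul U σ) = bondMul (uCut qU Λ U) σ := by
  rw [uCut_def, uCut_def, h, surfMul_bondMul]

/-- kernel: and the block field of the translated display is unchanged. [cite: BalabanImbrieJaffe1988, (5.5.2) p.283] -/
theorem vCut_bondMul {Λ : Finset (PBond P (k+1))} {U σ : GaugeField P k U1} (h : qU (bondMul U σ) = qU U) (v' : GaugeField P (k+1) U1) :
    vCut qU Λ (bondMul U σ) v' = vCut qU Λ U v' := by
  funext c; simp only [vCut_apply, h]

/-- The shift `u ↦ u·s` as a measurable equivalence of the configuration space (product of the right translations of the `U(1)` factors).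
[cite: BalabanImbrieJaffe1988, (5.5.2) p.283] -/
def bondMulEquiv (s : GaugeField P k U1) : GaugeField P k U1 ≃ᵐ GaugeField P k U1 :=
  MeasurableEquiv.piCongrRight fun b : PBond P k => MeasurableEquiv.mulRight (s b)

/-- kernel: the equivalence is the shift. [cite: BalabanImbrieJaffe1988, (5.5.2) p.283] -/
theorem bondMulEquiv_apply (s U : GaugeField P k U1) : bondMulEquiv s U = bondMul U s := rfl

/-- kernel: as a function the equivalence is the shift. [cite: BalabanImbrieJaffe1988, (5.5.2) p.283] -/
theorem coe_bondMulEquiv (s : GaugeField P k U1) : (bondMulEquiv s : GaugeField P k U1 → GaugeField P k U1) = fun U => bondMul U s := rfl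

/-- kernel: the shift is measurable. [cite: BalabanImbrieJaffe1988, (5.5.2) p.283] -/
theorem measurable_bondMul (s : GaugeField P k U1) : Measurable fun U : GaugeField P k U1 => bondMul U s :=
  (bondMulEquiv s).measurable

/-- **`𝒟u` is invariant under every shift** (right-invariance of the product Haar measure, the tree's `AveragingRT.measurePreserving_mulRight`).
[cite: BalabanImbrieJaffe1988, (5.5.2) p.283] -/
theorem fieldMeasure_map_bondMul (s : GaugeField P k U1) : (fieldMeasure P k U1).map (fun U => bondMul U s) = fieldMeasure P k U1 :=
  (AveragingRT.measurePreserving_mulRight (P := P) (j := k) (G := U1) s).map_eq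

/-- kernel: a shift trivial on the frozen bonds commutes with the axial gauge fix `u ↦ u[T := 1]` (any decidability instance).
[cite: BalabanImbrieJaffe1988, (5.1.4) p.278] -/
theorem fixBonds_bondMul {inst : DecidableEq (PBond P k)} {T : Finset (PBond P k)} {s : GaugeField P k U1} (hs : ∀ b ∈ T, s b = 1)
    (U : GaugeField P k U1) : fixBonds T (bondMul U s) = bondMul (fixBonds T U) s := by
  funext b
  by_cases hb : b ∈ T
  · rw [fixBonds_apply_of_mem hb, bondMul_apply, fixBonds_apply_of_mem hb, hs b hb, one_mul]
  · rw [fixBonds_apply_of_not_mem hb, bondMul_apply, bondMul_apply, fixBonds_apply_of_not_mem hb]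

/-- kernel: the law of `u[T := 1]` under `𝒟u` is invariant under shifts trivial on `T` (any decidability instance). [cite: BalabanImbrieJaffe1988, (5.1.4) p.278] -/
theorem map_bondMul_map_fixBonds {inst : DecidableEq (PBond P k)} {T : Finset (PBond P k)} {s : GaugeField P k U1} (hs : ∀ b ∈ T, s b = 1) :
    ((fieldMeasure P k U1).map (fixBonds T)).map (fun U => bondMul U s) = (fieldMeasure P k U1).map (fixBonds T) := by
  have hfix : Measurable (fixBonds T : GaugeField P k U1 → GaugeField P k U1) := @measurable_fixBonds P k U1 _ _ inst T
  rw [Measure.map_map (measurable_bondMul s) hfix]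
  have e : ((fun U => bondMul U s) ∘ fixBonds T) = fixBonds T ∘ fun U : GaugeField P k U1 => bondMul U s := by
    funext U; exact (fixBonds_bondMul hs U).symm
  rw [e, ← Measure.map_map hfix (measurable_bondMul s), fieldMeasure_map_bondMul]

/-- **`∫𝒟u δ_{Ax}(u)(·)` is invariant under every shift trivial on the axial tree bonds** — the measure form of *"δ_{Ax}(A′) = δ_{Ax}(A^{(k)})"* (p. 284)
for a translation `A′ = A^{(k)} − h` with `h` in axial gauge (*"Our construction of a C^{(k)}_{loc} satisfying (2.10) … ensures"* it).
[cite: BalabanImbrieJaffe1988, (5.5.2) p.284] -/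
theorem axialMeasure_map_bondMul {s : GaugeField P k U1} (hs : ∀ b ∈ (axialBonds : Finset (PBond P k)), s b = 1) :
    (axialMeasure P k U1).map (fun U => bondMul U s) = axialMeasure P k U1 := by
  unfold axialMeasure
  exact map_bondMul_map_fixBonds hs

/-- kernel: measure invariance packaged as `MeasurePreserving` of the equivalence (the form Mathlib's change-of-variables lemma takes).
[cite: BalabanImbrieJaffe1988, (5.5.2) p.283] -/
theorem measurePreserving_bondMulEquiv {ν : Measure (GaugeField P k U1)} {s : GaugeField P k U1} (hν : ν.map (fun U => bondMul U s) = ν) :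
    MeasurePreserving (bondMulEquiv s) ν ν :=
  ⟨(bondMulEquiv s).measurable, by rw [coe_bondMulEquiv]; exact hν⟩

/-- **The change of variables under an invariant law**: `∫ν F(u·s) = ∫ν F(u)` for EVERY `F` (no measurability needed: `u ↦ u·s` is a measurable
equivalence preserving `ν`; Mathlib's `MeasurePreserving.integral_comp'`). [cite: BalabanImbrieJaffe1988, (5.5.2) p.283] -/
theorem integral_comp_bondMul {ν : Measure (GaugeField P k U1)} {s : GaugeField P k U1} (hν : ν.map (fun U => bondMul U s) = ν)
    {E : Type*} [NormedAddCommGroup E] [NormedSpace ℝ E] (F : GaugeField P k U1 → E) :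
    ∫ U, F (bondMul U s) ∂ν = ∫ U, F U ∂ν :=
  (measurePreserving_bondMulEquiv hν).integral_comp' F

end Shift

/-! ## §2 The pointwise heart: the shifted integrand at the shifted configuration -/

section Pointwise

variable {Λ : Finset (PBond P (k+1))} {S : Set (GaugeField P k U1)} {σ : GaugeField P k U1}

/-- kernel: **if `u′_Λ(u)·σ` is a small field, the block averages of `u` are unchanged by the shift** — from `Q((u′_Λσ)·σ⁻¹) = Q(u′_Λσ)` (hypothesis
(B2) at `u′_Λσ ∈ S`) and `u = u′_Λ·Q^{s*}(cutoff_Λ Qu)`, `Q(x·Q^{s*}w) = (Qx)·w` (r18's `qU_surfMul`; standing range). [cite: BalabanImbrieJaffe1988, (5.5.2) p.284] -/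
theorem qU_bondMul_eq_of_uCut_bondMul_mem (hk : k + 1 ≤ P.m + P.K)
    (hQS : ∀ u' ∈ S, qU (bondMul u' σ) = qU u' ∧ qU (bondMul u' fun b => (σ b)⁻¹) = qU u')
    {U : GaugeField P k U1} (hmem : bondMul (uCut qU Λ U) σ ∈ S) : qU (bondMul U σ) = qU U := by
  have h2 := (hQS _ hmem).2
  rw [bondMul_bondMul_inv] at h2
  -- `u·σ = (u′_Λ·σ)·Q^{s*}(cutoff_Λ Qu)`
  have e : bondMul U σ = surfMul (bondMul (uCut qU Λ U) σ) (cutoff Λ (qU U)) := by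
    rw [surfMul_bondMul, translCut_uCut_qU]
  rw [e, qU_surfMul hk, ← h2, ← qU_surfMul hk, translCut_uCut_qU]

/-- kernel: **if `(u·σ)′_Λ` is a small field, the block averages of `u` are unchanged by the shift** — from `Q(((uσ)′_Λ)·σ⁻¹) = Q((uσ)′_Λ)` (hypothesis (B2))
and `((uσ)′_Λ)·σ⁻¹ = u·Q^{s*}(cutoff_Λ (Q(uσ))⁻¹)`. [cite: BalabanImbrieJaffe1988, (5.5.2) p.284] -/
theorem qU_bondMul_eq_of_uCut_mem (hk : k + 1 ≤ P.m + P.K)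
    (hQS : ∀ u' ∈ S, qU (bondMul u' σ) = qU u' ∧ qU (bondMul u' fun b => (σ b)⁻¹) = qU u')
    {U : GaugeField P k U1} (hmem : uCut qU Λ (bondMul U σ) ∈ S) : qU (bondMul U σ) = qU U := by
  have h2 := (hQS _ hmem).2
  have e : bondMul (uCut qU Λ (bondMul U σ)) (fun b => (σ b)⁻¹) = surfMul U (cutoff Λ fun c => (qU (bondMul U σ) c)⁻¹) := by
    rw [uCut_def, ← surfMul_bondMul, bondMul_bondMul_inv]
  rw [e, uCut_def, qU_surfMul hk, qU_surfMul hk] at h2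
  funext c
  have hc := congr_fun h2 c
  exact (mul_right_cancel hc).symm

/-- **THE POINTWISE IDENTITY BEHIND (5.5.2)**: for a term integrand `J₀({u^{(j)}}, u′, v, φ, ψ)` vanishing unless `u′ ∈ S` (B1), a shift `σ` with
`Q(u′·σ) = Q(u′) = Q(u′·σ⁻¹)` on `S` (B2), and ANY test factor `g`, at every configuration `(u, v′)`:
`J₀(u′_Λ(u·σ), v_Λ(u·σ, v′)) · g(v_Λ(u·σ, v′), ψ) = J₀(u′_Λ(u)·σ, v_Λ(u, v′)) · g(v_Λ(u, v′), ψ)` — where `Q(u·σ) = Q(u)` because the translated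
variables shift exactly, where `Q(u·σ) ≠ Q(u)` because both integrand values vanish (standing range). [cite: BalabanImbrieJaffe1988, (5.5.2) p.284] -/
theorem integrand_shift_eq (hk : k + 1 ≤ P.m + P.K) {X : Type*} (J₀ : Prev P k → GaugeField P k U1 → GaugeField P (k+1) U1 → HiggsField P k → X → ℂ)
    (hsupp : ∀ prev u' v φ x, J₀ prev u' v φ x ≠ 0 → u' ∈ S)
    (hQS : ∀ u' ∈ S, qU (bondMul u' σ) = qU u' ∧ qU (bondMul u' fun b => (σ b)⁻¹) = qU u')
    (g : GaugeField P (k+1) U1 → X → ℂ) (U : GaugeField P k U1) (v' : GaugeField P (k+1) U1) (prev : Prev P k) (φ : HiggsField P k) (x : X) :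
    J₀ prev (uCut qU Λ (bondMul U σ)) (vCut qU Λ (bondMul U σ) v') φ x * g (vCut qU Λ (bondMul U σ) v') x =
      J₀ prev (bondMul (uCut qU Λ U) σ) (vCut qU Λ U v') φ x * g (vCut qU Λ U v') x := by
  by_cases h : qU (bondMul U σ) = qU U
  · rw [uCut_bondMul h, vCut_bondMul h]
  · -- both integrand values vanish
    have h1 : J₀ prev (uCut qU Λ (bondMul U σ)) (vCut qU Λ (bondMul U σ) v') φ x = 0 := by
      by_contra hne
      exact h (qU_bondMul_eq_of_uCut_mem hk hQS (hsupp _ _ _ _ _ hne))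
    have h2 : J₀ prev (bondMul (uCut qU Λ U) σ) (vCut qU Λ U v') φ x = 0 := by
      by_contra hne
      exact h (qU_bondMul_eq_of_uCut_bondMul_mem hk hQS (hsupp _ _ _ _ _ hne))
    rw [h1, h2, zero_mul, zero_mul]

end Pointwise

/-! ## §3 (5.5.2) at measure level: the shifted integrand defines the same density -/

section Transl

variable {ι : Type*} {ν : Measure (GaugeField P k U1)} {terms : Finset ι} {Λ : ι → Finset (PBond P (k+1))}
variable {J : ι → Prev P k → GaugeField P k U1 → GaugeField P (k+1) U1 → HiggsField P k → HiggsField P (k+1) → ℂ}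
variable {ρL : GaugeField P (k+1) U1 → HiggsField P (k+1) → ℂ}

/-- **THE SECOND GAUGE FIELD TRANSLATION (5.5.2) AT MEASURE LEVEL.**  Let `ρ^L_{k+1}` satisfy line 1 of (5.9.6), `IsDT ν terms Λ qU J`, for the
printed block average.  Let `s_t(w)` be the multiplicative shift of the term `t` as a function of the block field (only its values at
`w = v|_{Λ_t}`, the free components, are used: `σ = s_t(cutoff_{Λ_t} v)`), such that (A) *"δ_{Ax}(A′) = δ_{Ax}(A^{(k)})"*: `ν` is invariant under
`u ↦ u·s_t(w)` for every `w`; (B) *"δ(QA′) = δ(QA^{(k)})"* on the support: for sets `S_t` with (B1) `J_t({u^{(j)}}, u′, v, φ, ψ) ≠ 0 ⇒ u′ ∈ S_t` and (B2)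
`u′ ∈ S_t ⇒ Q(u′·s_t(w)) = Q(u′) = Q(u′·s_t(w)⁻¹)`.  THEN `ρ^L_{k+1}` satisfies line 1 of (5.9.6) with the SHIFTED integrand
`J^s_t({u^{(j)}}, u^{(k)}, v, φ, ψ) := J_t({u^{(j)}}, u^{(k)}·s_t(cutoff_{Λ_t} v), v, φ, ψ)` — the old bracket read in the new variable `A^{(k)}`, `A′ =
A^{(k)} − h(f)`.  Proof: for each term and each `v′`, the change of variables `u ↦ u·σ` under `ν` (`integral_comp_bondMul`, no integrability needed)
followed by the pointwise identity `integrand_shift_eq` inside the remaining integrals (standing range). [cite: BalabanImbrieJaffe1988, (5.5.2) p.283] -/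
theorem isDT_bondShift (hk : k + 1 ≤ P.m + P.K) (s : ι → GaugeField P (k+1) U1 → GaugeField P k U1)
    (hν : ∀ t ∈ terms, ∀ w, ν.map (fun U => bondMul U (s t w)) = ν)
    (S : ι → Set (GaugeField P k U1)) (hsupp : ∀ t ∈ terms, ∀ prev u' v φ ψ, J t prev u' v φ ψ ≠ 0 → u' ∈ S t)
    (hQS : ∀ t ∈ terms, ∀ u' ∈ S t, ∀ w, qU (bondMul u' (s t w)) = qU u' ∧ qU (bondMul u' fun b => (s t w b)⁻¹) = qU u')
    (h : IsDT ν terms Λ qU J ρL) :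
    IsDT ν terms Λ qU (fun t prev u' v φ ψ => J t prev (bondMul u' (s t (cutoff (Λ t) v))) v φ ψ) ρL := by
  intro g hg hb
  rw [h g hg hb]
  refine Finset.sum_congr rfl fun t ht => ?_
  refine integral_congr_ae (ae_of_all _ fun v' => ?_)
  dsimp only
  -- change of variables `u ↦ u·σ`, `σ = s_t(cutoff v′)`, in the `ν`-integral (no integrability needed)
  refine (integral_comp_bondMul (hν t ht (cutoff (Λ t) v'))
    (fun U => ∫ prev, ∫ ψ, ∫ φ, J t prev (uCut qU (Λ t) U) (vCut qU (Λ t) U v') φ ψ * g (vCut qU (Λ t) U v', ψ)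
      ∂volume ∂volume ∂prevMeasure P k)).symm.trans ?_
  refine integral_congr_ae (ae_of_all _ fun U => ?_)
  dsimp only
  refine integral_congr_ae (ae_of_all _ fun prev => ?_)
  refine integral_congr_ae (ae_of_all _ fun ψ => ?_)
  refine integral_congr_ae (ae_of_all _ fun φ => ?_)
  dsimp only
  rw [integrand_shift_eq hk (σ := s t (cutoff (Λ t) v')) (fun prev u' v φ ψ => J t prev u' v φ ψ) (hsupp t ht)
    (fun u' hu' => hQS t ht u' hu' _) (fun v ψ => g (v, ψ)) U v' prev φ ψ, cutoff_vCut]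

/-- **Instance `ν = ∫𝒟u δ_{Ax}(u)(·)`** (the measure of (5.9.6)): hypothesis (A) holds for shifts trivial on the axial tree bonds
(`axialMeasure_map_bondMul`). [cite: BalabanImbrieJaffe1988, (5.5.2) p.284] -/
theorem isDT_bondShift_axial (hk : k + 1 ≤ P.m + P.K) (s : ι → GaugeField P (k+1) U1 → GaugeField P k U1)
    (hs : ∀ t ∈ terms, ∀ w, ∀ b ∈ (axialBonds : Finset (PBond P k)), s t w b = 1)
    (S : ι → Set (GaugeField P k U1)) (hsupp : ∀ t ∈ terms, ∀ prev u' v φ ψ, J t prev u' v φ ψ ≠ 0 → u' ∈ S t)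
    (hQS : ∀ t ∈ terms, ∀ u' ∈ S t, ∀ w, qU (bondMul u' (s t w)) = qU u' ∧ qU (bondMul u' fun b => (s t w b)⁻¹) = qU u')
    (h : IsDT (axialMeasure P k U1) terms Λ qU J ρL) :
    IsDT (axialMeasure P k U1) terms Λ qU (fun t prev u' v φ ψ => J t prev (bondMul u' (s t (cutoff (Λ t) v))) v φ ψ) ρL :=
  isDT_bondShift hk s (fun t ht w => axialMeasure_map_bondMul (hs t ht w)) S hsupp hQS h

/-- **Instance `ν = 𝒟u`**: hypothesis (A) holds for every shift. [cite: BalabanImbrieJaffe1988, (5.5.2) p.283] -/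
theorem isDT_bondShift_field (hk : k + 1 ≤ P.m + P.K) (s : ι → GaugeField P (k+1) U1 → GaugeField P k U1)
    (S : ι → Set (GaugeField P k U1)) (hsupp : ∀ t ∈ terms, ∀ prev u' v φ ψ, J t prev u' v φ ψ ≠ 0 → u' ∈ S t)
    (hQS : ∀ t ∈ terms, ∀ u' ∈ S t, ∀ w, qU (bondMul u' (s t w)) = qU u' ∧ qU (bondMul u' fun b => (s t w b)⁻¹) = qU u')
    (h : IsDT (fieldMeasure P k U1) terms Λ qU J ρL) :
    IsDT (fieldMeasure P k U1) terms Λ qU (fun t prev u' v φ ψ => J t prev (bondMul u' (s t (cutoff (Λ t) v))) v φ ψ) ρL :=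
  isDT_bondShift hk s (fun t _ w => fieldMeasure_map_bondMul (s t w)) S hsupp hQS h

/-- **Globally `Q`-preserving shifts need no support hypothesis**: if `Q(u′·s_t(w)) = Q(u′)` for ALL `u′` (e.g. the trivial shift, or any shift
for a multiplicative block average), (B1)–(B2) hold with `S_t` = everything. [cite: BalabanImbrieJaffe1988, (5.5.2) p.284] -/
theorem isDT_bondShift_of_forall (hk : k + 1 ≤ P.m + P.K) (s : ι → GaugeField P (k+1) U1 → GaugeField P k U1)
    (hν : ∀ t ∈ terms, ∀ w, ν.map (fun U => bondMul U (s t w)) = ν)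
    (hQ : ∀ t ∈ terms, ∀ u' w, qU (bondMul u' (s t w)) = qU u') (h : IsDT ν terms Λ qU J ρL) :
    IsDT ν terms Λ qU (fun t prev u' v φ ψ => J t prev (bondMul u' (s t (cutoff (Λ t) v))) v φ ψ) ρL := by
  refine isDT_bondShift hk s hν (fun _ => Set.univ) (fun _ _ _ _ _ _ _ _ => Set.mem_univ _) (fun t ht u' _ w => ⟨hQ t ht u' w, ?_⟩) h
  have h1 := hQ t ht (bondMul u' fun b => (s t w b)⁻¹) w
  rw [bondMul_inv_bondMul] at h1
  exact h1.symm

end Transl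

end

end Literature.MathematicalPhysics.QuantumFieldTheory.BalabanImbrieJaffe1984to88.BIJ88RT552Transl
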